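import Mathlib
import Summits.KontsevichZagierPeriods.Zeta5Search.WedgeDictionaryTopPairDatum
import HarnessLib

/-!
# Brown–Zudilin's recursion for the symmetric integrals `I_n` FOLLOWS from their printed `I₀, I₁, I₂` (via the wedge dictionary)
# (cell `pub-zeta5`, seat ct-1 g20)

HONEST FRAMING: systematic search; no irrationality claim unless certified.  OUR work (Summit side); statements about identities
between real numbers (Brown–Zudilin's absolutely convergent totally symmetric cellular integrals `I_n = I(n·1⁸)` and the solutions
`Q_n, P̂_n, P_n` of their Sect. 2 recursion); nothing about `ζ(5)`, no linear form bounded, no denominator or exponent.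

`Literature/…/BrownZudilin2022/TotallySymmetricDecomposition.lean` types TWO named facts of arXiv:2210.03391, Sect. 2: `I_init` (the
printed values `I₀ = θ`, `I₁`, `I₂`, θ = 2ζ(5)+4ζ(3)ζ(2); a HyperInt computation in the source) and `I_solvesRec` (the third-order
Apéry-type recursion for the `I_n`, `n ≥ 2`; a HolonomicFunctions computer proof in the source), and PROVES the decomposition (5)
`I_n = Q_nθ − 4P̂_nζ(2) − 2P_n` for all `n` from both.  With ct-1 g20's `WedgeDictionaryTopPairDatum.explicitPQ_of_I_init` (gen-1's wedge
dictionary from `I_init` alone) and the cell's diagonal identities `SymRay.bz_Q_ray / bz_Phat_ray / bz_P_ray` (Brown–Zudilin's `Q_n, P̂_n, P_n`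
ARE the dictionary minors on the diagonal, all `n`), the SECOND named fact is REDUNDANT:

* §1 `regionHyp_aDiag` — the diagonal point `n·1⁸` with partner `1` lies in the region of the dictionary for every `n ≥ 1`;
  `Isym_eq_of_explicitPQAt` — the dictionary identity at `n·1⁸` IS the decomposition (5) at `n` (converse of
  `WedgeDictionaryDiagData.explicitPQAt_aDiag_of_eq`); `Isym_eq_of_explicitPQ` — `explicitPQ` gives (5) for every `n ≥ 1`;
* §2 **`symmetricDecomposition_of_I_init : I_init → ∀ n, I_n = Q_nθ − 4P̂_nζ(2) − 2P_n`** and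
  **`I_solvesRec_of_I_init : I_init → I_solvesRec`** — CONDITIONAL on `I_init` exactly as typed, Brown–Zudilin's recursion for the
  integrals holds (the typed named fact `I_solvesRec` is a consequence of the typed named fact `I_init`); `explicitPQAt_aDiag_of_I_init`
  (the dictionary on the whole diagonal, every `n`), `fourTermContiguity_of_I_init`;
* §3 `I_init_iff : I_init ↔ (Isym 0 = zeta5hat ∧ explicitPQ)` — the printed table of Sect. 2 and gen-1's wedge dictionary are the SAME
  statement up to the value `I₀ = 2ζ(5)+4ζ(3)ζ(2)` of the bare cellular form (hypothesis-free equivalence).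

What this file is NOT: a proof of `I_init` (three weight-5 period computations), of `explicitPQ`, or of anything about irrationality;
records in print are unmoved.
-/

noncomputable section

open Finset

namespace Summit.KontsevichZagierPeriods.Zeta5Search.WedgeDictionaryDiagonalDecomposition

open Summit.KontsevichZagierPeriods.Zeta5Search.WedgeDictionary
open Summit.KontsevichZagierPeriods.Zeta5Search.SymRay
open Summit.KontsevichZagierPeriods.Zeta5Search.WedgeDictionaryTopPairDatum (explicitPQ_of_I_init explicitPQ_iff_diag2)
open Literature.NumberTheory.Irrationality
open Literature.NumberTheory.Irrationality.BrownZudilin2022 (bOfA Converges converges_symmetric cellularIntegral QOf I_init I_solvesRec Isym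
  zeta5hat Qsol Phat P rhs5_solvesRecReal)
open Literature.NumberTheory.Transcendental (zetaValue)

/-! ## 1. The diagonal instances of the dictionary are the decomposition (5) -/

/-- The diagonal point `a = n·1⁸` with partner `j = 1` lies in the region of the dictionary for `n ≥ 1`
(`b = (3n; n⁷)`: `0 ≤ 2n ≤ 3n+1`, `d = 2n ≥ 0`, `2(n+1) ≤ 3n+1`). [folklore] -/
theorem regionHyp_aDiag {n : ℕ} (hn : 1 ≤ n) : RegionHyp (aDiag n) 1 := by
  refine ⟨by simp, ?_, ?_, ?_, ?_⟩
  · exact converges_symmetric n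
  · intro i hi
    rw [Finset.mem_Icc] at hi
    obtain ⟨k, rfl⟩ : ∃ k, i = k + 1 := ⟨i - 1, by omega⟩
    rw [bOfA_diag, bRay_zero, bRay_succ n (mem_range.2 (by omega))]
    constructor <;> omega
  · rw [bOfA_diag, dOf_bRay]; omega
  · rw [bOfA_diag, bRay_zero, bRay_one]; omega

/-- **The dictionary identity at `n·1⁸` (partner `1`) IS the decomposition (5) at `n`**: `ExplicitPQAt (n·1⁸) 1` gives
`I_n = Q_nθ − 4P̂_nζ(2) − 2P_n` with Brown–Zudilin's `Q_n, P̂_n, P_n` (the recursion solutions `Qsol, Phat, P` with the printed initial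
data) — because these ARE the three dictionary minors on the diagonal (`bz_Q_ray`, `bz_Phat_ray`, `bz_P_ray`, all `n`). [folklore] -/
theorem Isym_eq_of_explicitPQAt {n : ℕ} (h : ExplicitPQAt (aDiag n) 1) :
    Isym n = (Qsol n : ℝ) * zeta5hat - 4 * (Phat n : ℝ) * zetaValue 2 - 2 * (P n : ℝ) := by
  unfold ExplicitPQAt dictPhat dictP at h
  rw [update_bOfA_diag, bOfA_diag, QOf_diag, rhoOf_diag, cellularIntegral_aDiag] at h
  rw [h, zeta5hat, ← SymmetricRecursion.Q_eq_Qsol n, bz_Phat_ray, bz_P_ray]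
  push_cast
  ring

/-- **`explicitPQ` gives the decomposition (5) for every `n ≥ 1`.** [folklore] -/
theorem Isym_eq_of_explicitPQ (h : explicitPQ) {n : ℕ} (hn : 1 ≤ n) :
    Isym n = (Qsol n : ℝ) * zeta5hat - 4 * (Phat n : ℝ) * zetaValue 2 - 2 * (P n : ℝ) :=
  Isym_eq_of_explicitPQAt (explicitPQ_iff_at.1 h _ _ (regionHyp_aDiag hn))

/-! ## 2. Given `I_init`: the decomposition for all `n`, and the recursion `I_solvesRec` -/

/-- **Given Brown–Zudilin's printed `I₀, I₁, I₂` (`I_init`), the decomposition (5) holds for EVERY `n`** — without the named fact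
`I_solvesRec` (compare `BrownZudilin2022.symmetricDecomposition`, which assumes both): `n = 0` is the first clause of `I_init`, `n ≥ 1` is
the wedge dictionary (`explicitPQ_of_I_init`) on the diagonal. [folklore] -/
theorem symmetricDecomposition_of_I_init (h : I_init) (n : ℕ) :
    Isym n = (Qsol n : ℝ) * zeta5hat - 4 * (Phat n : ℝ) * zetaValue 2 - 2 * (P n : ℝ) := by
  rcases Nat.eq_zero_or_pos n with rfl | hn
  · rw [h.1]; simp [Qsol, Phat, P]
  · exact Isym_eq_of_explicitPQ (explicitPQ_of_I_init h) hn

/-- **`I_init → I_solvesRec`: Brown–Zudilin's third-order recursion for the integrals `I_n` (their HolonomicFunctions computer proof,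
typed as the named fact `I_solvesRec`) FOLLOWS from the printed values `I₀, I₁, I₂` (the named fact `I_init`)** — the `I_n` coincide with
the combination `Q_nθ − 4P̂_nζ(2) − 2P_n` of recursion solutions, which solves the recursion (`rhs5_solvesRecReal`). [folklore] -/
theorem I_solvesRec_of_I_init (h : I_init) : I_solvesRec := by
  have e : Isym = fun n => (Qsol n : ℝ) * zeta5hat - 4 * (Phat n : ℝ) * zetaValue 2 - 2 * (P n : ℝ) :=
    funext (symmetricDecomposition_of_I_init h)
  unfold I_solvesRec
  rw [e]
  exact rhs5_solvesRecReal

/-- **The dictionary on the WHOLE diagonal from `I_init` alone**: `ExplicitPQAt (n·1⁸) 1` for every `n` (also `n = 0`) — compare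
`WedgeDictionary.explicitPQAt_aDiag`, which assumes `I_solvesRec` as well. [folklore] -/
theorem explicitPQAt_aDiag_of_I_init (h : I_init) (n : ℕ) : ExplicitPQAt (aDiag n) 1 :=
  WedgeDictionaryDiagData.explicitPQAt_aDiag_of_eq (symmetricDecomposition_of_I_init h n)

/-- **Given `I_init`, the four-term contiguity of the cellular integrals on the unit stencils** (`fourTermContiguity`, an internally
minted consequence of `explicitPQ`) holds. [folklore] -/
theorem fourTermContiguity_of_I_init (h : I_init) : fourTermContiguity :=
  fourTermContiguity_of_explicitPQ (explicitPQ_of_I_init h)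

/-! ## 3. `I_init` ⟺ `I₀ = θ` ∧ the wedge dictionary -/

/-- **The printed table of Sect. 2 and gen-1's wedge dictionary are the same statement up to `I₀`**:
`I_init ↔ (I₀ = 2ζ(5)+4ζ(3)ζ(2) ∧ explicitPQ)` (hypothesis-free equivalence; `→` is `explicitPQ_of_I_init`, `←` reads the
dictionary at `n = 1, 2`). [folklore] -/
theorem I_init_iff : I_init ↔ (Isym 0 = zeta5hat ∧ explicitPQ) := by
  refine ⟨fun h => ⟨h.1, explicitPQ_of_I_init h⟩, fun h => ⟨h.1, ?_, ?_⟩⟩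
  · rw [Isym_eq_of_explicitPQ h.2 (n := 1) le_rfl]; simp [Qsol, Phat, P]
  · rw [Isym_eq_of_explicitPQ h.2 (n := 2) (by norm_num)]; simp [Qsol, Phat, P]

/-- **Equivalently with the two diagonal instances**: `I_init ↔ (I₀ = θ ∧ ExplicitPQAt 1⁸ 1 ∧ ExplicitPQAt 2⁸ 1)`. [folklore] -/
theorem I_init_iff_diag2 :
    I_init ↔ (Isym 0 = zeta5hat ∧ ExplicitPQAt ![1, 1, 1, 1, 1, 1, 1, 1] 1 ∧ ExplicitPQAt ![2, 2, 2, 2, 2, 2, 2, 2] 1) := by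
  rw [I_init_iff, explicitPQ_iff_diag2]

end Summit.KontsevichZagierPeriods.Zeta5Search.WedgeDictionaryDiagonalDecomposition

end
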